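import Literature.AnabelianGeometry.SemiGraphs.TreeSystemFixedPoint
import Literature.AnabelianGeometry.SemiGraphs.TreeSystemFixedClosedEdges
import Literature.AnabelianGeometry.SemiGraphs.ArithEdgeLikeTwoHosts
import Literature.AnabelianGeometry.SemiGraphs.TemperedVerticialNotEdgeLike
import HarnessLib

/-!
# [SemiAnbd] Thm 3.7 / §5 p. 65: a verticial subgroup fixes AT MOST ONE compatible system of tree vertices

Mochizuki, *Semi-graphs of anabelioids*, Publ. RIMS **42** (2006), proof of Thm 3.7 (iii), p. 41, and
§5, p. 65 («`Π^temp_{𝔊,v}` … the commensurator in `Π^temp_𝔊` of `Π^temp_{𝔾,v}`»).  The input **`huniq`**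
of abc-iut-w4-d059's generic core `mem_commensurator_map_iff_fixes` (row T54-0b,
`ArithCommensuratorStabilizer.lean`) — "a verticial subgroup of `π₁^temp(𝒢)` fixes at most one compatible
system of vertices of the trees `T_j`" — DISCHARGED over loose tree binders (this is item (c) of
abc-iut-w4-d059's 2026-08-26T00:51:21Z plan, taken by abc-iut-w4-d053):

* `SemiGraph.exists_fixed_branch_of_two_fixed_vertices` — a group fixing two distinct vertices `w₁ ≠ w₂`
  of a tree fixes the edge of a branch AT `w₁` (the first edge of the geodesic; Lemma 1.8 (ii)(b));
* `SemiGraph.finite_star_of_isImmersion` — local finiteness of a tree immersed in a finite level;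
* `ProfiniteSemiGraph.not_le_of_mem_verticialSubgroups_of_mem_edgeLikeSubgroups` — a verticial
  subgroup is contained in NO edge-like subgroup (hosts + Thm 3.7 (ii) + "verticial ≠ edge-like");
* **`ProfiniteSemiGraph.verticial_fixes_atMostOne`** — for trees `T_j` (directed levels, functorial
  transition morphisms `f`), actions `α_j : π₁^temp(𝒢) → Aut T_j` equivariant for `f`, without branch
  switching, locally finite (finite stars), and the one-sided (I3) dictionary «the stabiliser of an eventual
  compatible system of edges (with branches) lies in an edge-like subgroup»: if a verticial `H` fixes two
  compatible vertex systems `x`, `x'` then `x = x'`.  PROOF: if `x_{j₁} ≠ x'_{j₁}` then `x_j ≠ x'_j` for all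
  `j ≥ j₁`; the branches at `x_j` whose edge is `H`-fixed form finite nonempty sets stable under `f`
  (first edge of the geodesic `x_j — x'_j`), so Kőnig (`exists_compatible_of_finite`) gives a compatible
  system of `H`-fixed edges from level `j₁` on, whose branches `H` fixes (no switching); by (I3) `H ≤ L`
  for an edge-like `L` — impossible for a verticial `H`.
* `ProfiniteSemiGraph.verticial_fixes_atMostOne'` — the same in the literal binder shape of the core's
  `huniq` (`VN := {H | ∃ v, H ∈ verticialSubgroups c v}`, action `n ↦ ρ_j (ι n)`).

No side is taken on [IUTchIII] Cor 3.12; typed ≠ proved.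
[cite: MochizukiSemiAnbd2006, Thm 3.7 (iii), p. 41; §5, p. 65; Lem. 1.8 (ii)(b), p. 20]
-/

namespace Literature.AnabelianGeometry.SemiGraphs

open CategoryTheory

universe u v u'

namespace SemiGraph

/-- **Lemma 1.8 (ii)(b), with the incidence recorded**: if a group acting on a tree fixes two distinct
vertices `w₁ ≠ w₂`, then it fixes the edge of some branch abutting to `w₁` (the first edge of the geodesic
from `w₁` to `w₂`, which is fixed pointwise). [cite: MochizukiSemiAnbd2006, Lem. 1.8(ii)(b) p.20] -/
theorem exists_fixed_branch_of_two_fixed_vertices {G : SemiGraph.{u}} (hG : G.IsTree)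
    {Γ : Type u'} [Group Γ] (ρ : Γ →* Aut G) {w₁ w₂ : G.Vertex} (hne : w₁ ≠ w₂)
    (hw₁ : ∀ γ, (ρ γ).hom.vertexMap w₁ = w₁) (hw₂ : ∀ γ, (ρ γ).hom.vertexMap w₂ = w₂) :
    ∃ c : G.Branch, G.abuts c = some w₁ ∧ ∀ γ, (ρ γ).hom.edgeMap (G.edgeOf c) = G.edgeOf c := by
  have hA : G.subdivision.IsAcyclic := hG.isTree.isAcyclic
  obtain ⟨p, hp⟩ := hG.isTree.connected.exists_isPath (Sum.inl w₁) (Sum.inl w₂)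
  -- all nodes of the geodesic are fixed
  have hfix : ∀ z ∈ p.support, ∀ γ, nodeMap (ρ γ) z = z := fun z hz γ =>
    nodeMap_eq_self_of_isPath hA (ρ γ) (by simp [hw₁ γ]) (by simp [hw₂ γ]) p hp z hz
  set n := p.length with hn
  have hx0 : p.getVert 0 = Sum.inl w₁ := p.getVert_zero
  have hw12 : (Sum.inl w₁ : G.Node) ≠ Sum.inl w₂ := by simpa using hne
  have h0 : 0 < n := lt_length_of_getVert_ne p (Nat.zero_le _) (by rw [hx0]; exact hw12)
  obtain ⟨c₁, hc₁w, hx1⟩ := step_vertex p h0 hx0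
  have h1 : 1 < n := lt_length_of_getVert_ne p h0 (by rw [hx1]; simp)
  -- node 2 is the edge of `c₁` (not `w₁` again)
  have hx2 : p.getVert 2 = Sum.inr (Sum.inl (G.edgeOf c₁)) := by
    rcases step_branch p h1 hx1 with h | ⟨v, hv, h⟩
    · exact h
    · exfalso
      rw [hc₁w] at hv
      have hvw : v = w₁ := (Option.some.inj hv).symm
      rw [hvw] at h
      exact getVert_add_two_ne p hp (i := 0) (by omega) (h.trans hx0.symm)
  refine ⟨c₁, hc₁w, fun γ => ?_⟩
  have h := hfix _ (hx2 ▸ p.getVert_mem_support 2) γ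
  simpa using h

/-- **Local finiteness from an immersion into a finite level**: if `q : T → L` is an immersion of
semi-graphs (injective on stars) and `L` has finitely many branches, every star of `T` is finite (the
universal graph-covering of a finite graph is locally finite). [cite: MochizukiSemiAnbd2006, §1 pp.13-14] -/
theorem finite_star_of_isImmersion {T L : SemiGraph.{u}} (q : T ⟶ L) (hq : IsImmersion q)
    [Finite L.Branch] (v : T.Vertex) : Finite (T.Star v) :=
  Finite.of_injective _ (hq v)

end SemiGraph

namespace ProfiniteSemiGraph

variable {𝒢 : ProfiniteSemiGraph.{u}}

/-- **A verticial subgroup lies in no edge-like subgroup** (Thm 3.7): if `H ≤ L` with `H` verticial and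
`L` edge-like, then `L ≤ H₁` for a verticial host `H₁` (the LEMMA-E hosts), `H = H₁` by Thm 3.7 (ii)
(`eq_of_le_of_mem_verticialSubgroups`), so `L = H` would be verticial and edge-like at once
(`not_mem_edgeLikeSubgroups_of_mem_verticialSubgroups`). [cite: MochizukiSemiAnbd2006, Thm 3.7, pp. 40–41] -/
theorem not_le_of_mem_verticialSubgroups_of_mem_edgeLikeSubgroups (h𝒢 : 𝒢.Thm37Hypotheses)
    (hG : 𝒢.graph.IsGraph) (c : TemperedPiChart 𝒢) {v : 𝒢.graph.Vertex} {e : 𝒢.graph.Edge}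
    {H L : Subgroup c.G} (hH : H ∈ verticialSubgroups c v) (hL : L ∈ edgeLikeSubgroups c e)
    (hHL : H ≤ L) : False := by
  obtain ⟨b₁, b₂, -, h1e, -, -⟩ := 𝒢.graph.two_branches e
  have hL' : L ∈ edgeLikeSubgroups c (𝒢.graph.edgeOf b₁) := by rw [h1e]; exact hL
  obtain ⟨u, -, H₁, -, hH₁, -, -, hL₁, -⟩ :=
    exists_two_hosts_of_mem_edgeLikeSubgroups_of_isGraph h𝒢 hG c b₁ hL'
  have hHH₁ : H = H₁ :=
    eq_of_le_of_mem_verticialSubgroups verticialDistinct_holds h𝒢 c hH hH₁ (hHL.trans hL₁)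
  have hLH : L = H := le_antisymm (hL₁.trans hHH₁.symm.le) hHL
  rw [hLH] at hL
  exact not_mem_edgeLikeSubgroups_of_mem_verticialSubgroups h𝒢 c hH hL

section FixUnique

variable {c : TemperedPiChart 𝒢} {J : Type v} [Preorder J] [IsDirectedOrder J]
  (T : J → SemiGraph.{u}) (α : ∀ j, c.G →* Aut (T j)) (f : ∀ ⦃i j : J⦄, i ≤ j → (T j ⟶ T i))

/-- **A verticial subgroup fixes at most one compatible system of tree vertices** (the input `huniq` of
abc-iut-w4-d059's `mem_commensurator_map_iff_fixes`, [SemiAnbd] §5 p. 65 / proof of Thm 3.7 (iii) p. 41).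
Binders: trees `T_j` over a directed level order with functorial transition morphisms `f`
(`f_id`, `f_comp`), actions `α_j : π₁^temp(𝒢) → Aut T_j` equivariant for `f` (`hfα`) and without branch
switching (`hnoswap` — the actions are over `𝔾`), finite stars (`hfin` — `T_j` immerses into a finite
level, `SemiGraph.finite_star_of_isImmersion`), and the one-sided (I3) dictionary `hedge` (the shape of
the field `VerticialLevelData.edge` without its projection clause). [cite: MochizukiSemiAnbd2006, Thm 3.7 (iii), p. 41; §5, p. 65] -/
theorem verticial_fixes_atMostOne (h𝒢 : 𝒢.Thm37Hypotheses) (hG : 𝒢.graph.IsGraph)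
    (hT : ∀ j, (T j).IsTree)
    (f_id : ∀ j, f (le_refl j) = 𝟙 (T j))
    (f_comp : ∀ ⦃i j k : J⦄ (hij : i ≤ j) (hjk : j ≤ k), f hjk ≫ f hij = f (hij.trans hjk))
    (hfα : ∀ ⦃i j : J⦄ (h : i ≤ j) (n : c.G), (α j n).hom ≫ f h = f h ≫ (α i n).hom)
    (hnoswap : ∀ (j : J) (n : c.G) (b : (T j).Branch),
      (α j n).hom.edgeMap ((T j).edgeOf b) = (T j).edgeOf b → (α j n).hom.branchMap b = b)
    (hfin : ∀ (j : J) (y : (T j).Vertex), Finite ((T j).Star y))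
    (hedge : ∀ (j₁ : J) (ε : ∀ j : {j : J // j₁ ≤ j}, (T j.1).Edge),
      (∀ ⦃i j : {j : J // j₁ ≤ j}⦄ (h : i.1 ≤ j.1), (f h).edgeMap (ε j) = ε i) →
      ∃ (e : 𝒢.graph.Edge) (L : Subgroup c.G), L ∈ edgeLikeSubgroups c e ∧
        ∀ g : c.G, (∀ j, (α j.1 g).hom.edgeMap (ε j) = ε j ∧
          ∀ b : (T j.1).Branch, (T j.1).edgeOf b = ε j → (α j.1 g).hom.branchMap b = b) → g ∈ L)
    {v : 𝒢.graph.Vertex} {H : Subgroup c.G} (hH : H ∈ verticialSubgroups c v)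
    (x x' : ∀ j, (T j).Vertex)
    (hx : ∀ ⦃i j : J⦄ (h : i ≤ j), (f h).vertexMap (x j) = x i)
    (hx' : ∀ ⦃i j : J⦄ (h : i ≤ j), (f h).vertexMap (x' j) = x' i)
    (hHx : ∀ n ∈ H, ∀ j, (α j n).hom.vertexMap (x j) = x j)
    (hHx' : ∀ n ∈ H, ∀ j, (α j n).hom.vertexMap (x' j) = x' j) : x = x' := by
  classical
  by_contra hxx
  obtain ⟨j₁, hj₁⟩ : ∃ j₁, x j₁ ≠ x' j₁ := Function.ne_iff.mp hxx
  -- from level `j₁` on the two systems differ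
  have hne : ∀ j : {j : J // j₁ ≤ j}, x j.1 ≠ x' j.1 := by
    intro j h
    apply hj₁
    rw [← hx j.2, ← hx' j.2, h]
  haveI : IsDirectedOrder {j : J // j₁ ≤ j} := by
    refine ⟨fun a b => ?_⟩
    obtain ⟨k, hak, hbk⟩ := exists_ge_ge a.1 b.1
    exact ⟨⟨k, a.2.trans hak⟩, hak, hbk⟩
  -- pointwise equivariance on edges
  have hfαE : ∀ ⦃i j : J⦄ (h : i ≤ j) (n : c.G) (E : (T j).Edge),
      (f h).edgeMap ((α j n).hom.edgeMap E) = (α i n).hom.edgeMap ((f h).edgeMap E) := by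
    intro i j h n E
    have hE := congrArg (fun φ => SemiGraph.Hom.edgeMap φ E) (hfα h n)
    simpa only [SemiGraph.comp_edgeMap, Function.comp_apply] using hE
  -- the finite nonempty `f`-stable sets of branches at `x_j` with `H`-fixed edge
  let S : ∀ j : {j : J // j₁ ≤ j}, Set (T j.1).Branch := fun j =>
    {b | (T j.1).abuts b = some (x j.1) ∧ ∀ n ∈ H, (α j.1 n).hom.edgeMap ((T j.1).edgeOf b) = (T j.1).edgeOf b}
  have hSfin : ∀ j, (S j).Finite := by
    intro j
    haveI := hfin j.1 (x j.1)
    have hsub : S j ⊆ {b | (T j.1).abuts b = some (x j.1)} := fun b hb => hb.1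
    exact (Set.finite_coe_iff.mp (by exact (inferInstance : Finite ((T j.1).Star (x j.1))))).subset hsub
  have hSne : ∀ j, (S j).Nonempty := by
    intro j
    obtain ⟨c₁, hc₁, hfixc⟩ := SemiGraph.exists_fixed_branch_of_two_fixed_vertices (hT j.1)
      ((α j.1).comp H.subtype) (hne j) (fun n => hHx n.1 n.2 j.1) (fun n => hHx' n.1 n.2 j.1)
    exact ⟨c₁, hc₁, fun n hn => hfixc ⟨n, hn⟩⟩
  have hSmap : ∀ ⦃i j : {j : J // j₁ ≤ j}⦄ (h : i ≤ j) (b : (T j.1).Branch), b ∈ S j →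
      (f (show i.1 ≤ j.1 from h)).branchMap b ∈ S i := by
    intro i j h b hb
    refine ⟨?_, fun n hn => ?_⟩
    · rw [(f _).abuts_branchMap b (x j.1) hb.1, hx]
    · rw [(f _).edgeOf_branchMap, ← hfαE, hb.2 n hn]
  -- Kőnig: a compatible system of such branches, hence of `H`-fixed edges
  obtain ⟨β, hβS, hβ⟩ := SemiGraph.exists_compatible_of_finite (J := {j : J // j₁ ≤ j})
    (X := fun j => (T j.1).Branch) (fun i j h b => (f (show i.1 ≤ j.1 from h)).branchMap b)
    (fun j b => by simp [f_id]) (fun i j k hij hjk b => by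
      have hc := congrArg (fun φ => SemiGraph.Hom.branchMap φ b)
        (f_comp (show i.1 ≤ j.1 from hij) (show j.1 ≤ k.1 from hjk))
      simpa only [SemiGraph.comp_branchMap, Function.comp_apply] using hc) S hSfin hSne hSmap
  let ε : ∀ j : {j : J // j₁ ≤ j}, (T j.1).Edge := fun j => (T j.1).edgeOf (β j)
  have hε : ∀ ⦃i j : {j : J // j₁ ≤ j}⦄ (h : i.1 ≤ j.1), (f h).edgeMap (ε j) = ε i := by
    intro i j h
    simp only [ε]
    rw [← (f h).edgeOf_branchMap, hβ (show i ≤ j from h)]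
  obtain ⟨e, L, hL, hLfix⟩ := hedge j₁ ε hε
  -- `H` fixes the edges `ε_j` and (no switching) their branches, so `H ≤ L`
  have hHL : H ≤ L := by
    intro n hn
    refine hLfix n fun j => ⟨(hβS j).2 n hn, fun b hb => hnoswap j.1 n b ?_⟩
    rw [hb]
    exact (hβS j).2 n hn
  exact not_le_of_mem_verticialSubgroups_of_mem_edgeLikeSubgroups h𝒢 hG c hH hL hHL

/-- **The core's `huniq` binder, verbatim shape** (abc-iut-w4-d059's `mem_commensurator_map_iff_fixes` with
`VN := {H | ∃ v, H ∈ verticialSubgroups c v}` and the restricted action `n ↦ ρ_j (ι n)` of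
`π₁^temp(𝒢)` through `ι : π₁^temp(𝒢) → Π^temp_𝔊`), from `verticial_fixes_atMostOne`.
[cite: MochizukiSemiAnbd2006, §5, p. 65] -/
theorem verticial_fixes_atMostOne' {Gtp : Type u'} [Group Gtp] (ι : c.G →* Gtp)
    (ρ : ∀ j, Gtp →* Aut (T j)) (h𝒢 : 𝒢.Thm37Hypotheses) (hG : 𝒢.graph.IsGraph)
    (hT : ∀ j, (T j).IsTree)
    (f_id : ∀ j, f (le_refl j) = 𝟙 (T j))
    (f_comp : ∀ ⦃i j k : J⦄ (hij : i ≤ j) (hjk : j ≤ k), f hjk ≫ f hij = f (hij.trans hjk))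
    (hfρ : ∀ ⦃i j : J⦄ (h : i ≤ j) (n : c.G), (ρ j (ι n)).hom ≫ f h = f h ≫ (ρ i (ι n)).hom)
    (hnoswap : ∀ (j : J) (n : c.G) (b : (T j).Branch),
      (ρ j (ι n)).hom.edgeMap ((T j).edgeOf b) = (T j).edgeOf b → (ρ j (ι n)).hom.branchMap b = b)
    (hfin : ∀ (j : J) (y : (T j).Vertex), Finite ((T j).Star y))
    (hedge : ∀ (j₁ : J) (ε : ∀ j : {j : J // j₁ ≤ j}, (T j.1).Edge),
      (∀ ⦃i j : {j : J // j₁ ≤ j}⦄ (h : i.1 ≤ j.1), (f h).edgeMap (ε j) = ε i) →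
      ∃ (e : 𝒢.graph.Edge) (L : Subgroup c.G), L ∈ edgeLikeSubgroups c e ∧
        ∀ g : c.G, (∀ j, (ρ j.1 (ι g)).hom.edgeMap (ε j) = ε j ∧
          ∀ b : (T j.1).Branch, (T j.1).edgeOf b = ε j → (ρ j.1 (ι g)).hom.branchMap b = b) → g ∈ L) :
    ∀ H ∈ {H : Subgroup c.G | ∃ v : 𝒢.graph.Vertex, H ∈ verticialSubgroups c v},
      ∀ x x' : ∀ j, (T j).Vertex,
      (∀ ⦃i j : J⦄ (h : i ≤ j), (f h).vertexMap (x j) = x i) →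
      (∀ ⦃i j : J⦄ (h : i ≤ j), (f h).vertexMap (x' j) = x' i) →
      (∀ n ∈ H, ∀ j, (ρ j (ι n)).hom.vertexMap (x j) = x j) →
      (∀ n ∈ H, ∀ j, (ρ j (ι n)).hom.vertexMap (x' j) = x' j) → x = x' := by
  intro H hH x x' hx hx' hHx hHx'
  obtain ⟨v, hHv⟩ := hH
  exact verticial_fixes_atMostOne T (fun j => (ρ j).comp ι) f h𝒢 hG hT f_id f_comp hfρ hnoswap hfin
    hedge hHv x x' hx hx' hHx hHx'

end FixUnique

end ProfiniteSemiGraph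

end Literature.AnabelianGeometry.SemiGraphs
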